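import Literature.Computability.AlgebraicComplexity.KRSTSelection
import Literature.Computability.AlgebraicComplexity.ValiantConjectureProofs
import HarnessLib

/-!
# The Kabanets–Impagliazzo generator on the permanent is `VNP`-succinct (Kumar–Ramya–Saptharishi–
# Tengse 2022, §3.4): `Σ_{|μ| ≤ n} x^μ · Perm_[p](y|_{S_μ})` is a Boolean sum of ONE small circuit

Topic `Computability/AlgebraicComplexity`. KRST §3.4 ("The VNP-Succinct-KI generator"): with the
Reed–Solomon design `S_μ` (`krstDesign`), the padded permanent `Perm_[p]` (`perPad`) and the bit
gadgets `Mon`, `Sel` (`KRSTSelection.lean`), the polynomial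
`F_{n,p}(x, z) = Σ_{t ∈ {0,1}^r} Mon(t, x) · Perm_[p](Sel(t, z))` "is in VNP … as `Perm_p` is in VNP
and `Mon`, `Sel` are efficiently computable", and its coefficient vector in `x` is
`KI-gen(Perm_[p])`. Here, for a NUMERIC seed `y : 𝔽_p × 𝔽_p → F` (what the succinct hitting-set
property consumes), we build one polynomial `witness` in the variables `x ⊕ (bits t ⊕ Ryser bits s)`
— `[Σ μ_i(t) ≤ n] · Mon(t, x) · g_M(Sel(t, y)∘pad, s)` with `g_M` the tree's Ryser–Valiant witness
`perVNPWitness` of the permanent (`boolSum g_M = per_M`) — and PROVE: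

* `sum_aeval_witness` — its Boolean sum over `(t, s)` is the target polynomial
  `Σ_{μ ∈ degLEMonomials n} Perm_[p](y ∘ S_μ) · x^μ` (`target`), i.e. the KI generator's output at
  the seed `y` read as a degree-`≤ n` polynomial (`coeff_target`, `totalDegree_target_le`);
* size/degree bounds and the packaging as a Boolean sum over `Fin u` are in
  `KRSTSuccinctnessBounds.lean`; the `SmallDefinable` membership is concluded in
  `Literature/Barriers/ValiantsHypothesis/AlgebraicNaturalProofsKRSTVNP.lean`.

Characteristic zero (the Lagrange gadgets). The degree truncation of KRST §3.5 is replaced by the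
explicit indicator `[Σ_i μ_i ≤ n]` inside the Boolean sum.

## References

* [KumarRamyaSaptharishiTengse2022] M. Kumar, C. Ramya, R. Saptharishi, A. Tengse, *If VNP is
  hard, then so are equations for it*, STACS 2022, §3.4 (eq. (3.1), "evident from the definition
  that `F_{n,a,p}` is in VNP"), §3.5.
* [BurgisserClausenShokrollahi1997] P. Bürgisser, M. Clausen, M. A. Shokrollahi, *Algebraic
  Complexity Theory*, Prop. (21.15) (the permanent as a Boolean sum; tree `perVNPWitness`).
-/

noncomputable section

namespace Literature.Computability.AlgebraicComplexity

open Literature.Barriers.ValiantsHypothesis MvPolynomial Finset CircuitArith BoolGadgets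

namespace KRSTSucc

section Assembly

variable (F : Type*) [Field F] {n K M p : ℕ} [Fact p.Prime] (hmp : M * M ≤ p)
  (y : ZMod p × ZMod p → F)

/-- The Boolean block: bits `t_{i,k}` of the exponent vector, and the `M` Ryser bits `s_j` of the
permanent's witness. [cite: KumarRamyaSaptharishiTengse2022, §3.4] -/
abbrev Blk (n K M : ℕ) : Type := (Fin n × Fin K) ⊕ Fin M

/-- All variables of the witness: `x ⊕ (t ⊕ s)`. [cite: KumarRamyaSaptharishiTengse2022, §3.4] -/
abbrev Var (n K M : ℕ) : Type := Fin n ⊕ Blk n K M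

/-- Bit polynomials lifted into the full variable set. [cite: KumarRamyaSaptharishiTengse2022, §3.4] -/
def liftT : MvPolynomial (Fin n × Fin K) F →ₐ[F] MvPolynomial (Var n K M) F :=
  rename (Sum.inr ∘ Sum.inl)

/-- **`Mon`** (KRST §3.1, Obs. 9): `∏_{i,k} (t_{i,k} x_i^{2^k} + 1 - t_{i,k})`, value `x^{μ(t)}` at the
bits of `μ` — the tree's monomial selector `selProd`. [cite: KumarRamyaSaptharishiTengse2022, Observation 9] -/
def monSel : MvPolynomial (Var n K M) F :=
  selProd (fun l : Fin (n * K) => X (Sum.inr (Sum.inl (finProdFinEquiv.symm l))))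
    (fun l => X (Sum.inl (finProdFinEquiv.symm l).1) ^ (2 ^ ((finProdFinEquiv.symm l).2 : ℕ)))

/-- The permanent part: the Ryser–Valiant witness `g_M(Y, s)` of `per_M` with the matrix variable
`Y_{ab}` replaced by the selection polynomial of the block position `pad(a,b)`.
[cite: KumarRamyaSaptharishiTengse2022, §3.4] -/
def permSel : MvPolynomial (Var n K M) F :=
  aeval (Sum.elim (fun ab : Fin M × Fin M => liftT F (selPoly F y (permPad hmp ab)))
    (fun j : Fin M => X (Sum.inr (Sum.inr j)))) (perVNPWitness M F)

/-- **The witness** `[Σ μ_i(t) ≤ n] · Mon(t, x) · g_M(Sel(t, y) ∘ pad, s)`.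
[cite: KumarRamyaSaptharishiTengse2022, §3.4] -/
def witness [CharZero F] : MvPolynomial (Var n K M) F :=
  liftT F (degIndicator F n K) * monSel F * permSel F hmp y

/-- The Boolean substitution at `e : Blk → Bool` (`x` kept). [cite: KumarRamyaSaptharishiTengse2022, §3.4] -/
def bsub (e : Blk n K M → Bool) : Var n K M → MvPolynomial (Fin n) F :=
  Sum.elim X fun b => if e b then 1 else 0

/-- The target coefficients `Perm_[p](y ∘ S_μ)` — the KI generator's output at the seed `y`.
[cite: KumarRamyaSaptharishiTengse2022, §3.5] -/
def coefAt (μ : degLEMonomials n) : F := eval (y ∘ krstDesign p n μ) (perPad F hmp)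

/-- The target polynomial `Σ_{|μ| ≤ n} Perm_[p](y ∘ S_μ) x^μ`. [cite: KumarRamyaSaptharishiTengse2022, §3.5] -/
def target (n : ℕ) : MvPolynomial (Fin n) F :=
  ∑ μ : degLEMonomials n, C (coefAt F hmp y μ) * monomial (μ : Fin n →₀ ℕ) 1

variable {F}

/-! #### The target -/

omit [Fact p.Prime] in
/-- Coefficients of the target. [cite: KumarRamyaSaptharishiTengse2022, §3.5] -/
theorem coeff_target [Fact p.Prime] (μ : degLEMonomials n) :
    coeff (μ : Fin n →₀ ℕ) (target F hmp y n) = coefAt F hmp y μ := by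
  classical
  unfold target
  rw [coeff_sum, Finset.sum_eq_single μ]
  · rw [coeff_C_mul, coeff_monomial, if_pos rfl, mul_one]
  · intro ν _ hνμ
    rw [coeff_C_mul, coeff_monomial, if_neg (fun h => hνμ (Subtype.ext h)), mul_zero]
  · intro h; exact absurd (Finset.mem_univ μ) h

/-- The target has degree `≤ n`. [cite: KumarRamyaSaptharishiTengse2022, §3.5] -/
theorem totalDegree_target_le : (target F hmp y n).totalDegree ≤ n := by
  unfold target
  refine (totalDegree_finsetSum _ _).trans (Finset.sup_le fun μ _ => ?_)
  refine (totalDegree_mul _ _).trans ?_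
  rw [totalDegree_C, zero_add]
  refine (totalDegree_monomial_le _ _).trans ?_
  have h := μ.2
  simp only [degLEMonomials, Set.mem_setOf_eq, Finsupp.degree_apply] at h
  exact h

/-! #### Evaluating the pieces at a Boolean point -/

omit [Fact p.Prime] in
/-- `[b]` as a constant polynomial. [folklore] -/
private theorem ite_eq_C_toK {σ : Type*} (b : Bool) :
    (if b then (1 : MvPolynomial σ F) else 0) = C (toK F b) := by
  cases b <;> simp [toK]

omit [Fact p.Prime] in
/-- Lifted bit polynomials evaluate to constants at Boolean points. [cite: KumarRamyaSaptharishiTengse2022, §3.4] -/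
theorem aeval_bsub_liftT (e : Blk n K M → Bool) (Q : MvPolynomial (Fin n × Fin K) F) :
    aeval (bsub F e) (liftT F Q : MvPolynomial (Var n K M) F) =
      C (eval (bitPt F (e ∘ Sum.inl)) Q) := by
  unfold liftT
  have hf : (bsub F e ∘ (Sum.inr ∘ Sum.inl)) =
      fun ik : Fin n × Fin K => C (bitPt F (e ∘ Sum.inl) ik) := by
    funext ik
    simp [bsub, bitPt, ite_eq_C_toK]
  rw [aeval_rename, hf, aeval_C_comp]

omit [Fact p.Prime] in
/-- `Mon` at the bits `e`: the monomial `x^{μ(e)}`. [cite: KumarRamyaSaptharishiTengse2022, Observation 9] -/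
theorem aeval_bsub_monSel (e : Blk n K M → Bool) :
    aeval (bsub F e) (monSel F : MvPolynomial (Var n K M) F) =
      monomial (Finsupp.equivFunOnFinite.symm (decodeBits (e ∘ Sum.inl))) 1 := by
  unfold monSel
  rw [aeval_selProd _ _ _ (fun l => e (Sum.inl (finProdFinEquiv.symm l)))]
  · -- `∏_l [e l] x_{i(l)}^{2^{k(l)}} = x^{μ(e)}`
    simp only [map_pow, aeval_X, bsub, Sum.elim_inl]
    rw [show (∏ l : Fin (n * K), if e (Sum.inl (finProdFinEquiv.symm l)) then
          (X (finProdFinEquiv.symm l).1 : MvPolynomial (Fin n) F) ^ 2 ^ ((finProdFinEquiv.symm l).2 : ℕ)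
          else 1) =
        ∏ ik : Fin n × Fin K, if e (Sum.inl ik) then (X ik.1 : MvPolynomial (Fin n) F) ^ 2 ^ (ik.2 : ℕ) else 1
      from Fintype.prod_equiv finProdFinEquiv.symm _ _ fun _ => rfl]
    rw [Fintype.prod_prod_type, monomial_eq, C_1, one_mul, Finsupp.prod_fintype _ _ (fun _ => pow_zero _)]
    refine Finset.prod_congr rfl fun i _ => ?_
    simp only [Finsupp.coe_equivFunOnFinite_symm, decodeBits, ofBits_eq_sum]
    rw [← Finset.prod_pow_eq_pow_sum]
    refine Finset.prod_congr rfl fun k _ => ?_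
    simp only [Function.comp_apply]
    rcases Bool.eq_false_or_eq_true (e (Sum.inl (i, k))) with h | h <;> simp [h]
  · intro l
    simp [bsub, ite_eq_C_toK]

/-- The permanent part at the bits `e`: the constant `g_M(Ŷ(e), ŝ)` with `Ŷ_{ab} = Sel_{pad(a,b)}(e)`.
[cite: KumarRamyaSaptharishiTengse2022, §3.4] -/
theorem aeval_bsub_permSel (e : Blk n K M → Bool) :
    aeval (bsub F e) (permSel F hmp y : MvPolynomial (Var n K M) F) =
      C (eval (Sum.elim (fun ab : Fin M × Fin M =>
          eval (bitPt F (e ∘ Sum.inl)) (selPoly F y (permPad hmp ab)))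
        (fun j : Fin M => toK F (e (Sum.inr j)))) (perVNPWitness M F)) := by
  unfold permSel
  rw [← AlgHom.comp_apply, comp_aeval]
  have hf : (fun v => aeval (bsub F e) (Sum.elim
        (fun ab : Fin M × Fin M => liftT F (selPoly F y (permPad hmp ab)))
        (fun j : Fin M => (X (Sum.inr (Sum.inr j)) : MvPolynomial (Var n K M) F)) v)) =
      fun v => C (Sum.elim (fun ab : Fin M × Fin M =>
          eval (bitPt F (e ∘ Sum.inl)) (selPoly F y (permPad hmp ab)))
        (fun j : Fin M => toK F (e (Sum.inr j))) v) := by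
    funext v
    rcases v with ab | j
    · simp only [Sum.elim_inl, aeval_bsub_liftT]
    · simp [bsub, ite_eq_C_toK]
  rw [hf, aeval_C_comp]

omit [Fact p.Prime] in
/-- **Ryser–Valiant at a numeric matrix**: `Σ_{s ∈ {0,1}^M} g_M(Ŷ, s) = per_M(Ŷ)`.
[cite: BurgisserClausenShokrollahi1997, Prop. (21.15)] -/
theorem sum_eval_perVNPWitness (Ŷ : Fin M × Fin M → F) :
    ∑ es : Fin M → Bool, eval (Sum.elim Ŷ fun j => toK F (es j)) (perVNPWitness M F) =
      eval Ŷ (perPoly (Fin M) F) := by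
  have h := congrArg (eval Ŷ) (boolSum_perVNPWitness M F)
  rw [← h]
  unfold boolSum
  rw [eval_sum]
  refine Finset.sum_congr rfl fun es _ => ?_
  have hf : (fun i => eval Ŷ ((Sum.elim X fun j => if es j then (1 : MvPolynomial (Fin M × Fin M) F)
      else 0) i)) = Sum.elim Ŷ fun j => toK F (es j) := by
    funext v
    rcases v with ab | j
    · simp
    · cases es j <;> simp [toK]
  rw [aeval_eq_bind₁, show eval Ŷ (bind₁ (Sum.elim X fun j => if es j then
        (1 : MvPolynomial (Fin M × Fin M) F) else 0) (perVNPWitness M F)) =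
      eval (fun i => eval Ŷ ((Sum.elim X fun j => if es j then
        (1 : MvPolynomial (Fin M × Fin M) F) else 0) i)) (perVNPWitness M F)
      from eval₂Hom_bind₁ _ _ _ _, hf]

/-! #### The Boolean sum of the witness -/

variable [CharZero F]

/-- The witness at a Boolean point `(t, s)`. [cite: KumarRamyaSaptharishiTengse2022, §3.4] -/
theorem aeval_bsub_witness (e : Blk n K M → Bool) :
    aeval (bsub F e) (witness F hmp y) =
      C ((if ∑ i : Fin n, decodeBits (e ∘ Sum.inl) i ≤ n then (1 : F) else 0) *
          eval (Sum.elim (fun ab : Fin M × Fin M =>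
              eval (bitPt F (e ∘ Sum.inl)) (selPoly F y (permPad hmp ab)))
            (fun j : Fin M => toK F (e (Sum.inr j)))) (perVNPWitness M F)) *
        monomial (Finsupp.equivFunOnFinite.symm (decodeBits (e ∘ Sum.inl))) 1 := by
  unfold witness
  rw [map_mul, map_mul, aeval_bsub_liftT, eval_degIndicator, aeval_bsub_monSel, aeval_bsub_permSel,
    map_mul]
  ring

/-- The exponent vector of valid bits as a coordinate. [cite: KumarRamyaSaptharishiTengse2022, §3.4] -/
def toMono (et : Fin n × Fin K → Bool) (h : ∑ i : Fin n, decodeBits et i ≤ n) : degLEMonomials n :=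
  ⟨Finsupp.equivFunOnFinite.symm (decodeBits et), by
    simp only [degLEMonomials, Set.mem_setOf_eq, Finsupp.degree_eq_sum,
      Finsupp.coe_equivFunOnFinite_symm]
    exact h⟩

/-- **KRST §3.4, the Boolean-sum identity**: summing the witness over all Boolean points gives
`Σ_{|μ| ≤ n} Perm_[p](y ∘ S_μ) x^μ` (needs `n < 2^K`, so that every exponent `≤ n` has `K` bits).
[cite: KumarRamyaSaptharishiTengse2022, §3.4] -/
theorem sum_aeval_witness (hK : n < 2 ^ K) :
    ∑ e : Blk n K M → Bool, aeval (bsub F e) (witness F hmp y) = target F hmp y n := by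
  classical
  -- split the Boolean block
  rw [← (Equiv.sumArrowEquivProdArrow (Fin n × Fin K) (Fin M) Bool).symm.sum_comp]
  rw [Fintype.sum_prod_type]
  simp only [aeval_bsub_witness]
  -- inner sum over the Ryser bits
  have hinner : ∀ et : Fin n × Fin K → Bool,
      ∑ es : Fin M → Bool,
        C ((if ∑ i : Fin n, decodeBits
              (((Equiv.sumArrowEquivProdArrow (Fin n × Fin K) (Fin M) Bool).symm (et, es)) ∘ Sum.inl) i ≤ n
            then (1 : F) else 0) *
          eval (Sum.elim (fun ab : Fin M × Fin M =>
              eval (bitPt F (((Equiv.sumArrowEquivProdArrow (Fin n × Fin K) (Fin M) Bool).symm (et, es)) ∘ Sum.inl))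
                (selPoly F y (permPad hmp ab)))
            (fun j : Fin M => toK F (((Equiv.sumArrowEquivProdArrow (Fin n × Fin K) (Fin M) Bool).symm (et, es)) (Sum.inr j))))
            (perVNPWitness M F)) *
        monomial (Finsupp.equivFunOnFinite.symm
          (decodeBits (((Equiv.sumArrowEquivProdArrow (Fin n × Fin K) (Fin M) Bool).symm (et, es)) ∘ Sum.inl))) 1 =
      C ((if ∑ i : Fin n, decodeBits et i ≤ n then (1 : F) else 0) *
          eval (fun ab : Fin M × Fin M => eval (bitPt F et) (selPoly F y (permPad hmp ab)))
            (perPoly (Fin M) F)) *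
        monomial (Finsupp.equivFunOnFinite.symm (decodeBits et)) 1 := by
    intro et
    have h1 : ∀ es : Fin M → Bool,
        (((Equiv.sumArrowEquivProdArrow (Fin n × Fin K) (Fin M) Bool).symm (et, es)) ∘ Sum.inl) = et := by
      intro es; funext ik; simp
    have h2 : ∀ es : Fin M → Bool, ∀ j,
        ((Equiv.sumArrowEquivProdArrow (Fin n × Fin K) (Fin M) Bool).symm (et, es)) (Sum.inr j) = es j := by
      intro es j; simp
    simp only [h1, h2]
    rw [← Finset.sum_mul, ← map_sum, ← Finset.mul_sum, sum_eval_perVNPWitness]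
  simp only [hinner]
  -- reindex the valid bit vectors by the coordinates `μ`
  unfold target
  rw [← Finset.sum_filter_add_sum_filter_not (Finset.univ : Finset (Fin n × Fin K → Bool))
    (fun et : Fin n × Fin K → Bool => ∑ i, decodeBits et i ≤ n)]
  rw [Finset.sum_eq_zero (s := Finset.univ.filter fun et : Fin n × Fin K → Bool => ¬ ∑ i, decodeBits et i ≤ n)
    (fun et het => by rw [if_neg (Finset.mem_filter.1 het).2, zero_mul, C_0, zero_mul]), add_zero]
  refine Finset.sum_nbij' (fun et => if h : ∑ i, decodeBits et i ≤ n then toMono et h else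
      ⟨0, by simp [degLEMonomials]⟩)
    (fun μ => encodeBits (fun i => (μ : Fin n →₀ ℕ) i)) ?_ ?_ ?_ ?_ ?_
  · intro et _; exact Finset.mem_univ _
  · intro μ _
    refine Finset.mem_filter.2 ⟨Finset.mem_univ _, ?_⟩
    have hμ : ∀ i, (μ : Fin n →₀ ℕ) i < 2 ^ K := fun i =>
      lt_of_le_of_lt ((Finsupp.le_degree i _).trans μ.2) hK
    rw [decodeBits_encodeBits hμ]
    have := μ.2
    simp only [degLEMonomials, Set.mem_setOf_eq, Finsupp.degree_eq_sum] at this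
    exact this
  · intro et het
    simp [encodeBits_decodeBits, toMono, dif_pos (Finset.mem_filter.1 het).2]
  · intro μ _
    have hμ : ∀ i, (μ : Fin n →₀ ℕ) i < 2 ^ K := fun i =>
      lt_of_le_of_lt ((Finsupp.le_degree i _).trans μ.2) hK
    have hvalid : ∑ i, decodeBits (encodeBits fun i => (μ : Fin n →₀ ℕ) i : Fin n × Fin K → Bool) i ≤ n := by
      rw [decodeBits_encodeBits hμ]
      have := μ.2
      simp only [degLEMonomials, Set.mem_setOf_eq, Finsupp.degree_eq_sum] at this
      exact this
    rw [dif_pos hvalid]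
    apply Subtype.ext
    simp only [toMono]
    ext i
    simp [decodeBits_encodeBits hμ]
  · intro et het
    have hv : ∑ i, decodeBits et i ≤ n := (Finset.mem_filter.1 het).2
    rw [if_pos hv, one_mul, dif_pos hv]
    congr 2
    unfold coefAt perPad
    rw [eval_rename]
    have hf : (fun ab : Fin M × Fin M => eval (bitPt F et) (selPoly F y (permPad hmp ab))) =
        (y ∘ krstDesign p n (toMono et hv)) ∘ permPad hmp := by
      funext ab
      simp only [Function.comp_apply]
      exact eval_selPoly F y _ et (toMono et hv) (fun i => by simp [toMono])
    rw [hf]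

end Assembly

end KRSTSucc

end Literature.Computability.AlgebraicComplexity

end
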